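import Summits.AnomalousDissipation.AnomalousDissipation.Theses.SteadyMirrorGate
import Summits.AnomalousDissipation.AnomalousDissipation.Theses.PumpSignGate
import Summits.AnomalousDissipation.AnomalousDissipation.Theses.DegreeGate
import Summits.AnomalousDissipation.AnomalousDissipation.Theorems.MirrorVarietySteadyWeakIsGlobalLerayHopf

/-!
# Shared support `SteadyWeakIsGlobalLerayHopf` (stmt-AnomalousDissipation-33834) on the routes
# SteadyMirrorGate · PumpSignGate · DegreeGate — proved by name

The support item L «a steady weak solution `u ∈ V` of `NS_ν(f)` (`ν > 0`, `f` smooth, mean zero) with the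
energy equation `ν ‖∇u‖² = (u, f)`, read as the constant path from its own datum, is a global Leray–Hopf
solution with `meanEnergy = ∫ |u|²` and `meanDissipation = ν ‖∇u‖²» is a binder (`hL`) of the deciding
theorem `closes` of each of the three routes.  Its `def … : Prop` body is byte-identical with
`MirrorVariety.SteadyWeakIsGlobalLerayHopf` (stmt-AnomalousDissipation-2992), proved in
`Theorems/MirrorVarietySteadyWeakIsGlobalLerayHopf.lean` as `steadyWeakIsGlobalLerayHopf_proof`
(Galdi 2000, Def. 2.1; Doering–Foias 2002 §2; Robinson–Rodrigo–Sadowski 2016, Def. 4.9), exactly as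
`Theorems/TaylorCertificatesSteadyWeakIsGlobalLerayHopf.lean` records the same alias for the TaylorCertificates
copy (stmt-AnomalousDissipation-14885).  This file records the alias under the three route names; nothing
else is (re)proved.  (Refuter note of record on the item, 2026-08-30T15:50Z: «SETTLED modulo landing».)
decomp-ad cell, lens-6 g57.
-/

-- `Summit.<Summit>.<Problem>` is the tree's mandated summit-side namespace (CONVENTIONS §2); for this
-- single-conjunct summit the two coincide, so the duplicate is deliberate.
set_option linter.dupNamespace false

namespace Summit.AnomalousDissipation.AnomalousDissipation.Theorems

/-- **Route decl `SteadyMirrorGate.SteadyWeakIsGlobalLerayHopf` (stmt-AnomalousDissipation-33834), proved**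
by definitional unfolding to `steadyWeakIsGlobalLerayHopf_proof`. [folklore] -/
theorem steadyMirrorGate_steadyWeakIsGlobalLerayHopf_holds :
    Summit.AnomalousDissipation.AnomalousDissipation.Theses.SteadyMirrorGate.SteadyWeakIsGlobalLerayHopf := by
  unfold Summit.AnomalousDissipation.AnomalousDissipation.Theses.SteadyMirrorGate.SteadyWeakIsGlobalLerayHopf
  exact steadyWeakIsGlobalLerayHopf_proof

/-- **Route decl `PumpSignGate.SteadyWeakIsGlobalLerayHopf` (stmt-AnomalousDissipation-33834), proved**
by definitional unfolding to `steadyWeakIsGlobalLerayHopf_proof`. [folklore] -/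
theorem pumpSignGate_steadyWeakIsGlobalLerayHopf_holds :
    Summit.AnomalousDissipation.AnomalousDissipation.Theses.PumpSignGate.SteadyWeakIsGlobalLerayHopf := by
  unfold Summit.AnomalousDissipation.AnomalousDissipation.Theses.PumpSignGate.SteadyWeakIsGlobalLerayHopf
  exact steadyWeakIsGlobalLerayHopf_proof

/-- **Route decl `DegreeGate.SteadyWeakIsGlobalLerayHopf` (stmt-AnomalousDissipation-33834), proved**
by definitional unfolding to `steadyWeakIsGlobalLerayHopf_proof`. [folklore] -/
theorem degreeGate_steadyWeakIsGlobalLerayHopf_holds :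
    Summit.AnomalousDissipation.AnomalousDissipation.Theses.DegreeGate.SteadyWeakIsGlobalLerayHopf := by
  unfold Summit.AnomalousDissipation.AnomalousDissipation.Theses.DegreeGate.SteadyWeakIsGlobalLerayHopf
  exact steadyWeakIsGlobalLerayHopf_proof

end Summit.AnomalousDissipation.AnomalousDissipation.Theorems
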